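import Summits.BirchSwinnertonDyer.BirchSwinnertonDyer.Theorems.TwinTransportX9TwoStep6627b1

/-!
# Route `TwinTransportX9` — WITNESS REGIME (second disjunct) of the deciding crux `TrivialTwinSupplyX9` (item 24080):
# the `S`-restricted case at the pair `(6627b1, p = 5)` and the BY-NAME second-disjunct witness

Tribunal bookkeeping for the T3 test (BC5, witness of weakness), companion of `TwinTransportX9WitnessRegime`
(pair `(11808a1, 5)`, first disjunct). The second-disjunct rung `rung2_6627b1_5` (file `TwinTransportX9TwoStep6627b1`,
kit PARI job j305596) sits at an analytic-rank-0 X9 pair of conductor `6627 ≥ 5000` — the branch of the crux body that the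
route's transport statement actually consumes on even-rank twin classes. This module (whose name sorts among the
`TwinTransportX9Rung*` files, hence inside the tribunal's per-route theorem window) supplies:

* `sCase_6627b1_5` — the route's `closes` target `Rank1Residual.BSDpOnClassX9` RESTRICTED VERBATIM to `(W, p) = (6627b1, 5)`,
  with `sCase_6627b1_5_of_leaf : BSDpOnClassX9 → sCase_6627b1_5`. A `Prop` definition, not a theorem: no theorem of the tree
  proves `BSD_5(6627b1)` — the `p`-part engines in the tree for analytic rank `≤ 1` carry the image hypotheses `(sur)`/`(im)`
  which FAIL on class X9 by definition (`¬ W.HasSurjectiveModNGaloisRep p`; here image `5S4`), and the printed full-BSD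
  verifications cover conductor `N < 5000`, while `N(6627b1) = 6627`, `N(V₁) = 801867`, `N(V₂) = 103345420827`.
* `rung2_6627b1_5_decides` — `rung2_6627b1_5` restated so that its TYPE names the crux constant:
  `(TrivialTwinSupplyX9 → body(6627b1, 5)) ∧ body(6627b1, 5)` under the rung's displayed binders.

HONEST FRAMING: BSD is NOT proved; `TrivialTwinSupplyX9` is NOT proved (named open in print, Prasanna 2010 p. 400);
`sCase_6627b1_5` is NOT proved either (it is the open `S`-case, stated, not asserted). Nothing here is new mathematics.

References: Matar–Nekovář 2019 Thm. 0.3 [MatarNekovar2019]; Kolyvagin 1990 Thm. A [KolyvaginEulerSystems1990];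
Burungale–Castella–Skinner 2025 §1.2, Prop. 5.2.1 [BurungaleCastellaSkinner2025]; Prasanna 2010 p. 400 [Prasanna2010CJM];
Jetchev–Skinner–Wan 2017 Thm. 1.2.1 (hypotheses (sur), (irr)) [JetchevSkinnerWan2017]; Cremona's database [Cremona2006].
-/

set_option linter.dupNamespace false
set_option autoImplicit false

noncomputable section

open scoped Classical NumberField

open WeierstrassCurve Literature.NumberTheory.EllipticCurves
  Literature.NumberTheory.EllipticCurves.Rank1Residual.X11RankOneCertificates
  Summit.BirchSwinnertonDyer.BirchSwinnertonDyer.Rank1Residual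
  Summit.BirchSwinnertonDyer.BirchSwinnertonDyer.Theses.TwinTransportX9

namespace Summit.BirchSwinnertonDyer.BirchSwinnertonDyer.Theorems.TwinTransportX9Rung

/-! ## §1 The `S`-restricted case at the second-disjunct witness pair -/

/-- **The `S`-restricted case (T3 `s_case`).** The route's `closes` target `BSDpOnClassX9` restricted verbatim to
the pair `(6627b1, 5)`: `BSD_5` of `6627b1 = [0,-1,1,-31,-66]` in analytic rank `≤ 1` on class X9.
OPEN: stated as a `Prop`, not asserted; no theorem of the tree or of print decides it (`N = 6627 ≥ 5000`, image `5S4`).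
[cite: Prasanna2010CJM, p. 400 (Introduction)] [cite: JetchevSkinnerWan2017, Thm. 1.2.1] -/
@[conjecture] def sCase_6627b1_5 : Prop :=
  haveI := isElliptic_6627b1; haveI := isGloballyMinimal_6627b1; haveI : Fact (Nat.Prime 5) := ⟨by norm_num⟩
  (⟨0, -1, 1, -31, -66⟩ : WeierstrassCurve ℚ).analyticRank ≤ 1 →
    ClassX9 (⟨0, -1, 1, -31, -66⟩ : WeierstrassCurve ℚ) 5 →
      Finite (⟨0, -1, 1, -31, -66⟩ : WeierstrassCurve ℚ).sha → PPartBSD (⟨0, -1, 1, -31, -66⟩ : WeierstrassCurve ℚ) 5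

/-- `sCase_6627b1_5` IS the restriction of the leaf `BSDpOnClassX9` to the pair `(6627b1, 5)`. -/
theorem sCase_6627b1_5_of_leaf (h : BSDpOnClassX9) : sCase_6627b1_5 :=
  @h (⟨0, -1, 1, -31, -66⟩ : WeierstrassCurve ℚ) isElliptic_6627b1 isGloballyMinimal_6627b1 5 ⟨by norm_num⟩

/-! ## §2 The by-name second-disjunct witness -/

/-- **BY-NAME SECOND-DISJUNCT WITNESS (T3) of the deciding crux `TrivialTwinSupplyX9`.** Under the displayed binders of
`rung2_6627b1_5` (an auxiliary quadratic field `K₀` of discriminant `-11`; the published named facts `kolyvagin 801867 V₁ K₁`,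
Matar–Nekovář Thm. 0.3 for `(V₁, K₁)`, `disc K₁ = -359`; and the ENGINE data of kit PARI job j305596): the crux body at
`(6627b1, 5)` HOLDS (second conjunct, `rung2_6627b1_5`: outer frame `(-11, 37)`, inner frame `(-359, 37)`, second disjunct),
and that body is VERBATIM the crux's instance (first conjunct, `rung2_isInstance_6627b1_5`). BSD is NOT proved; the crux
is NOT proved in general. [cite: MatarNekovar2019, Thm. 0.3 (p. 456)] [cite: KolyvaginEulerSystems1990, Thm. A]
[cite: BurungaleCastellaSkinner2025, §1.2, Prop. 5.2.1] -/
theorem rung2_6627b1_5_decides {K₀ : Type} [Field K₀] [NumberField K₀] (hK₀ : Module.finrank ℚ K₀ = 2) (hdK₀ : NumberField.discr K₀ = -11)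
    {K₁ : Type} [Field K₁] [NumberField K₁] (hK₁ : IsImaginaryQuadratic K₁) (hdK₁ : NumberField.discr K₁ = -359)
    (hKo : kolyvagin 801867 (⟨0, -1, 1, -3791, 102629⟩ : WeierstrassCurve ℚ) K₁)
    (hMN : MatarNekovar2019.thm03_padicValNat_card_sha_le_of_irreducible 801867 (⟨0, -1, 1, -3791, 102629⟩ : WeierstrassCurve ℚ) K₁)
    {P : ((⟨0, -1, 1, -3791, 102629⟩ : WeierstrassCurve ℚ).baseChange K₁).toAffine.Point} (hP : IsHeegnerPoint 801867 (⟨0, -1, 1, -3791, 102629⟩ : WeierstrassCurve ℚ) K₁ P) (hnt : ¬ IsOfFinAddOrder P)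
    (hI : ¬ 5 ∣ (AddSubgroup.zmultiples P).index) (hr₂ : (⟨0, -1, 1, -488630831, -4689844786441⟩ : WeierstrassCurve ℚ).analyticRank = 0)
    (hL₂ : (⟨0, -1, 1, -488630831, -4689844786441⟩ : WeierstrassCurve ℚ).leadingLCoeff / ((⟨0, -1, 1, -488630831, -4689844786441⟩ : WeierstrassCurve ℚ).realPeriodRat : ℂ) = ((16 : ℚ) : ℂ)) :
    haveI := isElliptic_6627b1; haveI := isGloballyMinimal_6627b1; haveI : Fact (Nat.Prime 5) := ⟨by norm_num⟩
    (TrivialTwinSupplyX9 →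
      (ClassX9 (⟨0, -1, 1, -31, -66⟩ : WeierstrassCurve ℚ) 5 → ¬ 5 ∣ (⟨0, -1, 1, -31, -66⟩ : WeierstrassCurve ℚ).tamagawaProduct → ∃ dK dF : ℤ, BCSAdmissiblePair (⟨0, -1, 1, -31, -66⟩ : WeierstrassCurve ℚ) 5 dK dF ∧
      ∃ (V₁ : WeierstrassCurve ℚ) (_ : V₁.IsElliptic) (_ : V₁.IsGloballyMinimal),
        (∃ C : WeierstrassCurve.VariableChange ℚ, C • V₁ = (⟨0, -1, 1, -31, -66⟩ : WeierstrassCurve ℚ).quadraticTwist (dK : ℚ)) ∧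
        ((V₁.analyticRank = 0 ∧ ¬ 5 ∣ V₁.shaOrder ∧ ¬ 5 ∣ V₁.tamagawaProduct ∧ ¬ 5 ∣ V₁.torsionOrder ∧
            ∃ q : ℚ, V₁.leadingLCoeff / (V₁.realPeriodRat : ℂ) = (q : ℂ) ∧ padicValRat 5 q = 0) ∨
          ∃ dK' dF' : ℤ, BCSAdmissiblePair V₁ 5 dK' dF' ∧
            ∃ (V₂ : WeierstrassCurve ℚ) (_ : V₂.IsElliptic) (_ : V₂.IsGloballyMinimal),
              (∃ C : WeierstrassCurve.VariableChange ℚ, C • V₂ = V₁.quadraticTwist (dK' : ℚ)) ∧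
              (V₂.analyticRank = 0 ∧ ¬ 5 ∣ V₂.shaOrder ∧ ¬ 5 ∣ V₂.tamagawaProduct ∧ ¬ 5 ∣ V₂.torsionOrder ∧
                ∃ q : ℚ, V₂.leadingLCoeff / (V₂.realPeriodRat : ℂ) = (q : ℂ) ∧ padicValRat 5 q = 0)))) ∧
    (ClassX9 (⟨0, -1, 1, -31, -66⟩ : WeierstrassCurve ℚ) 5 → ¬ 5 ∣ (⟨0, -1, 1, -31, -66⟩ : WeierstrassCurve ℚ).tamagawaProduct → ∃ dK dF : ℤ, BCSAdmissiblePair (⟨0, -1, 1, -31, -66⟩ : WeierstrassCurve ℚ) 5 dK dF ∧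
      ∃ (V₁ : WeierstrassCurve ℚ) (_ : V₁.IsElliptic) (_ : V₁.IsGloballyMinimal),
        (∃ C : WeierstrassCurve.VariableChange ℚ, C • V₁ = (⟨0, -1, 1, -31, -66⟩ : WeierstrassCurve ℚ).quadraticTwist (dK : ℚ)) ∧
        ((V₁.analyticRank = 0 ∧ ¬ 5 ∣ V₁.shaOrder ∧ ¬ 5 ∣ V₁.tamagawaProduct ∧ ¬ 5 ∣ V₁.torsionOrder ∧
            ∃ q : ℚ, V₁.leadingLCoeff / (V₁.realPeriodRat : ℂ) = (q : ℂ) ∧ padicValRat 5 q = 0) ∨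
          ∃ dK' dF' : ℤ, BCSAdmissiblePair V₁ 5 dK' dF' ∧
            ∃ (V₂ : WeierstrassCurve ℚ) (_ : V₂.IsElliptic) (_ : V₂.IsGloballyMinimal),
              (∃ C : WeierstrassCurve.VariableChange ℚ, C • V₂ = V₁.quadraticTwist (dK' : ℚ)) ∧
              (V₂.analyticRank = 0 ∧ ¬ 5 ∣ V₂.shaOrder ∧ ¬ 5 ∣ V₂.tamagawaProduct ∧ ¬ 5 ∣ V₂.torsionOrder ∧
                ∃ q : ℚ, V₂.leadingLCoeff / (V₂.realPeriodRat : ℂ) = (q : ℂ) ∧ padicValRat 5 q = 0))) :=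
  ⟨rung2_isInstance_6627b1_5, rung2_6627b1_5 hK₀ hdK₀ hK₁ hdK₁ hKo hMN hP hnt hI hr₂ hL₂⟩

end Summit.BirchSwinnertonDyer.BirchSwinnertonDyer.Theorems.TwinTransportX9Rung

end
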